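import Summits.ValiantsHypothesis.ValiantsHypothesis.Theorems.LacunarySymmetroidMatrixDescartesFiniteSectorSectorCeilingThirteenFiveWA
import Summits.ValiantsHypothesis.ValiantsHypothesis.Theorems.LacunarySymmetroidMatrixDescartesFiniteSectorSectorCeilingThirteenFiveWB
import Summits.ValiantsHypothesis.ValiantsHypothesis.Theorems.LacunarySymmetroidMatrixDescartesFiniteSectorIterMasksWalk
import Summits.ValiantsHypothesis.ValiantsHypothesis.Theorems.LacunarySymmetroidMatrixDescartesFiniteSector

/-!
# `MatrixDescartes` — line «finite»: the SECTOR CEILING `η(13,5) ≤ σ(13,5) = 1746` (kernel) — `HypRootLawAt 13 5 1746`, Conjecture Σ's value `2·n(13,4)`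

HONEST FRAMING.  Object-search cell `pub-symmetroid`, seat val-sym-door-p5 g11.  HELPER of the crux item `stmt-ValiantsHypothesis-18050` (`Theses.LacunarySymmetroid.MatrixDescartes`)
with NO closure claim.  The SIEVE of line «finite» (`FiniteSector.sieve`, `natDegree_mem_sumset`) makes the `13`-fold sums of exponents of an in-sector pencil a
step-≤-2 chain from `0` up to the degree; the finite core — no `4` positive values carry such a chain beyond `1746` — has 583 647 live prefixes and is
decided in the kernel in the WALKER shape of `…FiniteSectorIterMasksWalk` (seat val-sym-door-p5 g11; slices `sectorWalk_thirteen_five_s2_*` in `…FiniteSectorSectorCeilingThirteenFiveWA`, `…FiniteSectorSectorCeilingThirteenFiveWB`);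
the transfer reads the census sum set as capped multisets and peels the walker level by level (`walk_true`).  Result: `hypRootLawAt_thirteen_five_1746 : HypRootLawAt 13 5 1746`.
Located first (exact DFS): the chain survives to `1745` only on the doubled extremal basis `2·{0,1,9,56,155}` — `σ(13,5) = 1746 = 2·n(13,4)`, Conjecture Σ of `Lines/finite.md` at the cell
`(13,5)`; the lower side needs a realised doubled basis and is NOT claimed here.  Nothing here bears on the crux (asymptotic), on `H3`, on the doors, or on `VP ≠ VNP`.
[folklore] Gap-rule / sieve bookkeeping plus a finite enumeration (postage-stamp numbers `n(13,·)`); no citation is load-bearing.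
-/

-- `Summit.ValiantsHypothesis.ValiantsHypothesis.…` repeats a component by the D-0017 layout
-- (single-conjunct summit), which the `dupNamespace` linter flags; the name is mandated.
set_option linter.dupNamespace false

namespace Summit.ValiantsHypothesis.ValiantsHypothesis.Theorems.LacunarySymmetroidMatrixDescartes.FiniteSector

open scoped BigOperators Matrix
open Polynomial

/-! ## `(13,5)`: `σ(13,5) = 1746` -/

set_option maxHeartbeats 4000000 in
set_option maxRecDepth 100000 in
/-- **`η(13,5) ≤ 1746 = σ(13,5)`** — `HypRootLawAt 13 5 1746`: every in-sector (`#distinct real roots = natDegree`) determinant of a real symmetric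
`13 × 13` lacunary pencil with `5` terms has degree `≤ 1746` (SIEVE ⇒ step-≤-2 chain of `13`-fold sums; values capped at `1749`, padded, sorted; capped
multisets; the kernel walker slices, peeled level by level with `walk_true`). [folklore] -/
theorem hypRootLawAt_thirteen_five_1746 : HypRootLawAt 13 5 1746 := by
  intro d S hS hsec
  by_contra hdeg'
  have hdeg : 1746 < (pencil d S).det.natDegree := not_le.mp hdeg'
  have hq : (pencil d S).det ≠ 0 := by
    intro h0
    rw [h0] at hdeg
    simp at hdeg
  have hchain0 : ∀ r, r + 2 ≤ (pencil d S).det.natDegree →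
      r ∈ (Finset.univ : Finset (Sym (Fin 5) 13)).image (fun s : Sym (Fin 5) 13 => ((s : Multiset (Fin 5)).map d).sum) ∨
      r + 1 ∈ (Finset.univ : Finset (Sym (Fin 5) 13)).image (fun s : Sym (Fin 5) 13 => ((s : Multiset (Fin 5)).map d).sum) :=
    fun r hr => sieve d S hq hsec hr
  have htop0 := natDegree_mem_sumset d S hq
  set cv : Fin 5 → ℕ := fun i => min (d i) 1749 with hcv
  have hcvle : ∀ i, cv i ≤ 1749 := fun i => Nat.min_le_right _ _
  set V : Finset ℕ := Finset.univ.image cv with hV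
  have hcvV : ∀ i, cv i ∈ V := fun i => Finset.mem_image_of_mem cv (Finset.mem_univ i)
  have h0V : 0 ∈ V := by
    have key : ∃ i : Fin 5, d i = 0 := by
      rcases hchain0 0 (by omega) with h | h
      · obtain ⟨i, hi⟩ := exists_index_eq_zero d 1749 (by norm_num) (by norm_num) h
        refine ⟨i, ?_⟩
        rcases Nat.lt_or_ge (d i) 1749 with hlt | hge
        · rwa [Nat.min_eq_left hlt.le] at hi
        · rw [Nat.min_eq_right hge] at hi
          omega
      · obtain ⟨t, ht, hcard, hsum⟩ := exists_multiset_of_mem_sumset d 1749 ((List.finRange 5).map (fun i => min (d i) 1749))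
          (fun i => List.mem_map.mpr ⟨i, List.mem_finRange i, rfl⟩) (by norm_num) h
        have hex : ∃ x ∈ t, x = 0 := by
          by_contra hall
          push Not at hall
          have h1 : ∀ x ∈ t, 1 ≤ x := fun x hx => Nat.one_le_iff_ne_zero.mpr (hall x hx)
          have := Multiset.card_nsmul_le_sum h1
          rw [hcard] at this
          simp at this
          omega
        obtain ⟨x, hx, hx0⟩ := hex
        obtain ⟨j, -, hj⟩ := List.mem_map.mp (ht x hx)
        refine ⟨j, ?_⟩
        have := hj.trans hx0
        rcases Nat.lt_or_ge (d j) 1749 with hlt | hge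
        · rwa [Nat.min_eq_left hlt.le] at this
        · rw [Nat.min_eq_right hge] at this
          omega
    obtain ⟨i, hi⟩ := key
    have : cv i = 0 := by simp [hcv, hi]
    exact this ▸ hcvV i
  set W : Finset ℕ := V.erase 0 with hW
  have hWsub : W ⊆ (Finset.range 1750).erase 0 := by
    intro u hu
    rw [hW, Finset.mem_erase] at hu
    obtain ⟨hu0, huV⟩ := hu
    rw [hV, Finset.mem_image] at huV
    obtain ⟨i, -, rfl⟩ := huV
    rw [Finset.mem_erase, Finset.mem_range]
    exact ⟨hu0, Nat.lt_succ_of_le (hcvle i)⟩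
  have hWcard : W.card ≤ 4 := by
    have hVK : V.card ≤ 5 := by
      have := Finset.card_image_le (s := (Finset.univ : Finset (Fin 5))) (f := cv)
      simpa using this
    have h1 : W.card + 1 = V.card := by rw [hW]; exact Finset.card_erase_add_one h0V
    omega
  obtain ⟨W', hWW', hW'sub, hW'card⟩ := Finset.exists_subsuperset_card_eq hWsub hWcard
    (by rw [Finset.card_erase_of_mem (by simp), Finset.card_range]; omega)
  have hVW' : ∀ u ∈ V, u = 0 ∨ u ∈ W' := by
    intro u hu
    by_cases hu0 : u = 0
    · exact Or.inl hu0
    · exact Or.inr (hWW' (by rw [hW, Finset.mem_erase]; exact ⟨hu0, hu⟩))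
  have hlmem : ∀ u, u ∈ Finset.sort W' ↔ u ∈ W' := fun u => Finset.mem_sort _
  have hlsort : (Finset.sort W').SortedLT := Finset.sortedLT_sort W'
  have hllen : (Finset.sort W').length = 4 := by rw [Finset.length_sort, hW'card]
  generalize hl : Finset.sort W' = l at hlmem hlsort hllen
  rcases l with _ | ⟨a, _ | ⟨b, _ | ⟨c, _ | ⟨g, _ | ⟨zz, ll⟩⟩⟩⟩⟩
  all_goals simp only [List.length_cons, List.length_nil] at hllen
  all_goals try omega
  have hltC : ∀ u, u ∈ [a, b, c, g] → u < 1750 := by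
    intro u hu
    have hu' : u ∈ W' := (hlmem u).mp hu
    have := hW'sub hu'
    rw [Finset.mem_erase, Finset.mem_range] at this
    exact this.2
  have hgt : ∀ u, u ∈ [a, b, c, g] → 0 < u := by
    intro u hu
    have hu' : u ∈ W' := (hlmem u).mp hu
    have := hW'sub hu'
    rw [Finset.mem_erase] at this
    omega
  have hlt0 : 0 < a := hgt a (by simp)
  have hin : ∀ u ∈ V, u ∈ [0, a, b, c, g] := by
    intro u hu
    rcases hVW' u hu with h | h
    · rw [h]; simp
    · exact List.mem_cons_of_mem _ ((hlmem u).mpr h)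
  have hL : ∀ i, min (d i) 1749 ∈ [0, a, b, c, g] := fun i => by
    have := hin _ (hcvV i)
    simpa only [hcv] using this
  have hsumP : ∀ r, r ≤ 1748 →
      r ∈ (Finset.univ : Finset (Sym (Fin 5) 13)).image (fun s : Sym (Fin 5) 13 => ((s : Multiset (Fin 5)).map d).sum) →
      ∃ t : Multiset ℕ, (∀ x ∈ t, x ∈ [0, a, b, c, g]) ∧ Multiset.card t = 13 ∧ t.sum = r := by
    intro r hr hr'
    have key := exists_multiset_of_mem_sumset d 1749 [0, a, b, c, g] hL (Nat.lt_succ_of_le hr) hr'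
    exact key
  have hchainP : ∀ r, r ≤ 1745 → (∃ t : Multiset ℕ, (∀ x ∈ t, x ∈ [0, a, b, c, g]) ∧ Multiset.card t = 13 ∧ t.sum = r) ∨
      (∃ t : Multiset ℕ, (∀ x ∈ t, x ∈ [0, a, b, c, g]) ∧ Multiset.card t = 13 ∧ t.sum = r + 1) := by
    intro r hr
    rcases hchain0 r (by omega) with h | h
    · exact Or.inl (hsumP r (by omega) h)
    · exact Or.inr (hsumP (r + 1) (by omega) h)
  have hlt1 : a < b := by
    have := hlsort (show (⟨0, by simp⟩ : Fin [a, b, c, g].length) < ⟨1, by simp⟩ from Fin.mk_lt_mk.mpr (by norm_num))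
    simpa using this
  have hlt2 : b < c := by
    have := hlsort (show (⟨1, by simp⟩ : Fin [a, b, c, g].length) < ⟨2, by simp⟩ from Fin.mk_lt_mk.mpr (by norm_num))
    simpa using this
  have hlt3 : c < g := by
    have := hlsort (show (⟨2, by simp⟩ : Fin [a, b, c, g].length) < ⟨3, by simp⟩ from Fin.mk_lt_mk.mpr (by norm_num))
    simpa using this
  have hC0 : a < 1750 := hltC a (by simp)
  have hC1 : b < 1750 := hltC b (by simp)
  have hC2 : c < 1750 := hltC c (by simp)
  have hC3 : g < 1750 := hltC g (by simp)
  have hrest0 : ∀ y ∈ [a, b, c, g], a ≤ y := by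
    intro y hy
    simp only [List.mem_cons, List.mem_nil_iff, or_false] at hy
    omega
  have halive0 : ∀ r < min 1746 (a - 1), ((@Nat.rec (fun _ => ℕ) ((fun (E : ℕ) => @List.rec ℕ (fun _ => ℕ) 0 (fun (x : ℕ) (_ : List ℕ) (acc : ℕ) => Nat.lor acc (Nat.shiftLeft E x)) [0]) 1) (fun (_ acc : ℕ) => (fun (E : ℕ) => @List.rec ℕ (fun _ => ℕ) 0 (fun (x : ℕ) (_ : List ℕ) (acc : ℕ) => Nat.lor acc (Nat.shiftLeft E x)) [0]) acc) 12)).testBit r = true ∨ ((@Nat.rec (fun _ => ℕ) ((fun (E : ℕ) => @List.rec ℕ (fun _ => ℕ) 0 (fun (x : ℕ) (_ : List ℕ) (acc : ℕ) => Nat.lor acc (Nat.shiftLeft E x)) [0]) 1) (fun (_ acc : ℕ) => (fun (E : ℕ) => @List.rec ℕ (fun _ => ℕ) 0 (fun (x : ℕ) (_ : List ℕ) (acc : ℕ) => Nat.lor acc (Nat.shiftLeft E x)) [0]) acc) 12)).testBit (r + 1) = true := by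
    intro r hr
    rcases hchainP r (by omega) with ⟨t, ht, hcard, hsum⟩ | ⟨t, ht, hcard, hsum⟩
    · have ht' := multiset_prefix (l₁ := [0]) (l₂ := [a, b, c, g]) hrest0 (by omega) ht
      rw [← hsum]
      exact Or.inl (testBit_lagMask_of_multiset [0] 12 t ht' hcard)
    · have ht' := multiset_prefix (l₁ := [0]) (l₂ := [a, b, c, g]) hrest0 (by omega) ht
      rw [← hsum]
      exact Or.inr (testBit_lagMask_of_multiset [0] 12 t ht' hcard)
  have hz0 : ((@Nat.rec (fun _ => ℕ) ((fun (E : ℕ) => @List.rec ℕ (fun _ => ℕ) 0 (fun (x : ℕ) (_ : List ℕ) (acc : ℕ) => Nat.lor acc (Nat.shiftLeft E x)) [0]) 1) (fun (_ acc : ℕ) => (fun (E : ℕ) => @List.rec ℕ (fun _ => ℕ) 0 (fun (x : ℕ) (_ : List ℕ) (acc : ℕ) => Nat.lor acc (Nat.shiftLeft E x)) [0]) acc) 12)).testBit 0 = true := testBit_lagMask_zero [0] 12 (by simp)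
  have hg0 := alive_guards (Mp := (@Nat.rec (fun _ => ℕ) ((fun (E : ℕ) => @List.rec ℕ (fun _ => ℕ) 0 (fun (x : ℕ) (_ : List ℕ) (acc : ℕ) => Nat.lor acc (Nat.shiftLeft E x)) [0]) 1) (fun (_ acc : ℕ) => (fun (E : ℕ) => @List.rec ℕ (fun _ => ℕ) 0 (fun (x : ℕ) (_ : List ℕ) (acc : ℕ) => Nat.lor acc (Nat.shiftLeft E x)) [0]) acc) 12)) (lo := 0) (T := 1746) (c := a) hz0 halive0
  have hrest1 : ∀ y ∈ [b, c, g], b ≤ y := by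
    intro y hy
    simp only [List.mem_cons, List.mem_nil_iff, or_false] at hy
    omega
  have halive1 : ∀ r < min 1746 (b - 1), ((@Nat.rec (fun _ => ℕ) ((fun (E : ℕ) => @List.rec ℕ (fun _ => ℕ) 0 (fun (x : ℕ) (_ : List ℕ) (acc : ℕ) => Nat.lor acc (Nat.shiftLeft E x)) [0, a]) 1) (fun (_ acc : ℕ) => (fun (E : ℕ) => @List.rec ℕ (fun _ => ℕ) 0 (fun (x : ℕ) (_ : List ℕ) (acc : ℕ) => Nat.lor acc (Nat.shiftLeft E x)) [0, a]) acc) 12)).testBit r = true ∨ ((@Nat.rec (fun _ => ℕ) ((fun (E : ℕ) => @List.rec ℕ (fun _ => ℕ) 0 (fun (x : ℕ) (_ : List ℕ) (acc : ℕ) => Nat.lor acc (Nat.shiftLeft E x)) [0, a]) 1) (fun (_ acc : ℕ) => (fun (E : ℕ) => @List.rec ℕ (fun _ => ℕ) 0 (fun (x : ℕ) (_ : List ℕ) (acc : ℕ) => Nat.lor acc (Nat.shiftLeft E x)) [0, a]) acc) 12)).testBit (r + 1) = true := by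
    intro r hr
    rcases hchainP r (by omega) with ⟨t, ht, hcard, hsum⟩ | ⟨t, ht, hcard, hsum⟩
    · have ht' := multiset_prefix (l₁ := [0, a]) (l₂ := [b, c, g]) hrest1 (by omega) ht
      rw [← hsum]
      exact Or.inl (testBit_lagMask_of_multiset [0, a] 12 t ht' hcard)
    · have ht' := multiset_prefix (l₁ := [0, a]) (l₂ := [b, c, g]) hrest1 (by omega) ht
      rw [← hsum]
      exact Or.inr (testBit_lagMask_of_multiset [0, a] 12 t ht' hcard)
  have hz1 : ((@Nat.rec (fun _ => ℕ) ((fun (E : ℕ) => @List.rec ℕ (fun _ => ℕ) 0 (fun (x : ℕ) (_ : List ℕ) (acc : ℕ) => Nat.lor acc (Nat.shiftLeft E x)) [0, a]) 1) (fun (_ acc : ℕ) => (fun (E : ℕ) => @List.rec ℕ (fun _ => ℕ) 0 (fun (x : ℕ) (_ : List ℕ) (acc : ℕ) => Nat.lor acc (Nat.shiftLeft E x)) [0, a]) acc) 12)).testBit 0 = true := testBit_lagMask_zero [0, a] 12 (by simp)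
  have hg1 := alive_guards (Mp := (@Nat.rec (fun _ => ℕ) ((fun (E : ℕ) => @List.rec ℕ (fun _ => ℕ) 0 (fun (x : ℕ) (_ : List ℕ) (acc : ℕ) => Nat.lor acc (Nat.shiftLeft E x)) [0, a]) 1) (fun (_ acc : ℕ) => (fun (E : ℕ) => @List.rec ℕ (fun _ => ℕ) 0 (fun (x : ℕ) (_ : List ℕ) (acc : ℕ) => Nat.lor acc (Nat.shiftLeft E x)) [0, a]) acc) 12)) (lo := a) (T := 1746) (c := b) hz1 halive1
  have hrest2 : ∀ y ∈ [c, g], c ≤ y := by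
    intro y hy
    simp only [List.mem_cons, List.mem_nil_iff, or_false] at hy
    omega
  have halive2 : ∀ r < min 1746 (c - 1), ((@Nat.rec (fun _ => ℕ) ((fun (E : ℕ) => @List.rec ℕ (fun _ => ℕ) 0 (fun (x : ℕ) (_ : List ℕ) (acc : ℕ) => Nat.lor acc (Nat.shiftLeft E x)) [0, a, b]) 1) (fun (_ acc : ℕ) => (fun (E : ℕ) => @List.rec ℕ (fun _ => ℕ) 0 (fun (x : ℕ) (_ : List ℕ) (acc : ℕ) => Nat.lor acc (Nat.shiftLeft E x)) [0, a, b]) acc) 12)).testBit r = true ∨ ((@Nat.rec (fun _ => ℕ) ((fun (E : ℕ) => @List.rec ℕ (fun _ => ℕ) 0 (fun (x : ℕ) (_ : List ℕ) (acc : ℕ) => Nat.lor acc (Nat.shiftLeft E x)) [0, a, b]) 1) (fun (_ acc : ℕ) => (fun (E : ℕ) => @List.rec ℕ (fun _ => ℕ) 0 (fun (x : ℕ) (_ : List ℕ) (acc : ℕ) => Nat.lor acc (Nat.shiftLeft E x)) [0, a, b]) acc) 12)).testBit (r + 1) = true := by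
    intro r hr
    rcases hchainP r (by omega) with ⟨t, ht, hcard, hsum⟩ | ⟨t, ht, hcard, hsum⟩
    · have ht' := multiset_prefix (l₁ := [0, a, b]) (l₂ := [c, g]) hrest2 (by omega) ht
      rw [← hsum]
      exact Or.inl (testBit_lagMask_of_multiset [0, a, b] 12 t ht' hcard)
    · have ht' := multiset_prefix (l₁ := [0, a, b]) (l₂ := [c, g]) hrest2 (by omega) ht
      rw [← hsum]
      exact Or.inr (testBit_lagMask_of_multiset [0, a, b] 12 t ht' hcard)
  have hz2 : ((@Nat.rec (fun _ => ℕ) ((fun (E : ℕ) => @List.rec ℕ (fun _ => ℕ) 0 (fun (x : ℕ) (_ : List ℕ) (acc : ℕ) => Nat.lor acc (Nat.shiftLeft E x)) [0, a, b]) 1) (fun (_ acc : ℕ) => (fun (E : ℕ) => @List.rec ℕ (fun _ => ℕ) 0 (fun (x : ℕ) (_ : List ℕ) (acc : ℕ) => Nat.lor acc (Nat.shiftLeft E x)) [0, a, b]) acc) 12)).testBit 0 = true := testBit_lagMask_zero [0, a, b] 12 (by simp)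
  have hg2 := alive_guards (Mp := (@Nat.rec (fun _ => ℕ) ((fun (E : ℕ) => @List.rec ℕ (fun _ => ℕ) 0 (fun (x : ℕ) (_ : List ℕ) (acc : ℕ) => Nat.lor acc (Nat.shiftLeft E x)) [0, a, b]) 1) (fun (_ acc : ℕ) => (fun (E : ℕ) => @List.rec ℕ (fun _ => ℕ) 0 (fun (x : ℕ) (_ : List ℕ) (acc : ℕ) => Nat.lor acc (Nat.shiftLeft E x)) [0, a, b]) acc) 12)) (lo := b) (T := 1746) (c := c) hz2 halive2
  have hrest3 : ∀ y ∈ [g], g ≤ y := by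
    intro y hy
    simp only [List.mem_cons, List.mem_nil_iff, or_false] at hy
    omega
  have halive3 : ∀ r < min 1746 (g - 1), ((@Nat.rec (fun _ => ℕ) ((fun (E : ℕ) => @List.rec ℕ (fun _ => ℕ) 0 (fun (x : ℕ) (_ : List ℕ) (acc : ℕ) => Nat.lor acc (Nat.shiftLeft E x)) [0, a, b, c]) 1) (fun (_ acc : ℕ) => (fun (E : ℕ) => @List.rec ℕ (fun _ => ℕ) 0 (fun (x : ℕ) (_ : List ℕ) (acc : ℕ) => Nat.lor acc (Nat.shiftLeft E x)) [0, a, b, c]) acc) 12)).testBit r = true ∨ ((@Nat.rec (fun _ => ℕ) ((fun (E : ℕ) => @List.rec ℕ (fun _ => ℕ) 0 (fun (x : ℕ) (_ : List ℕ) (acc : ℕ) => Nat.lor acc (Nat.shiftLeft E x)) [0, a, b, c]) 1) (fun (_ acc : ℕ) => (fun (E : ℕ) => @List.rec ℕ (fun _ => ℕ) 0 (fun (x : ℕ) (_ : List ℕ) (acc : ℕ) => Nat.lor acc (Nat.shiftLeft E x)) [0, a, b, c]) acc) 12)).testBit (r + 1) = true := by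
    intro r hr
    rcases hchainP r (by omega) with ⟨t, ht, hcard, hsum⟩ | ⟨t, ht, hcard, hsum⟩
    · have ht' := multiset_prefix (l₁ := [0, a, b, c]) (l₂ := [g]) hrest3 (by omega) ht
      rw [← hsum]
      exact Or.inl (testBit_lagMask_of_multiset [0, a, b, c] 12 t ht' hcard)
    · have ht' := multiset_prefix (l₁ := [0, a, b, c]) (l₂ := [g]) hrest3 (by omega) ht
      rw [← hsum]
      exact Or.inr (testBit_lagMask_of_multiset [0, a, b, c] 12 t ht' hcard)
  have hz3 : ((@Nat.rec (fun _ => ℕ) ((fun (E : ℕ) => @List.rec ℕ (fun _ => ℕ) 0 (fun (x : ℕ) (_ : List ℕ) (acc : ℕ) => Nat.lor acc (Nat.shiftLeft E x)) [0, a, b, c]) 1) (fun (_ acc : ℕ) => (fun (E : ℕ) => @List.rec ℕ (fun _ => ℕ) 0 (fun (x : ℕ) (_ : List ℕ) (acc : ℕ) => Nat.lor acc (Nat.shiftLeft E x)) [0, a, b, c]) acc) 12)).testBit 0 = true := testBit_lagMask_zero [0, a, b, c] 12 (by simp)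
  have hg3 := alive_guards (Mp := (@Nat.rec (fun _ => ℕ) ((fun (E : ℕ) => @List.rec ℕ (fun _ => ℕ) 0 (fun (x : ℕ) (_ : List ℕ) (acc : ℕ) => Nat.lor acc (Nat.shiftLeft E x)) [0, a, b, c]) 1) (fun (_ acc : ℕ) => (fun (E : ℕ) => @List.rec ℕ (fun _ => ℕ) 0 (fun (x : ℕ) (_ : List ℕ) (acc : ℕ) => Nat.lor acc (Nat.shiftLeft E x)) [0, a, b, c]) acc) 12)) (lo := c) (T := 1746) (c := g) hz3 halive3
  have hleafA : Nat.beq (Nat.mod (Nat.lor (@Nat.rec (fun _ => ℕ) 1 (fun (k acc : ℕ) => Nat.lor (@Nat.rec (fun _ => ℕ) ((fun (E : ℕ) => @List.rec ℕ (fun _ => ℕ) 0 (fun (x : ℕ) (_ : List ℕ) (acc : ℕ) => Nat.lor acc (Nat.shiftLeft E x)) [0, a, b, c]) 1) (fun (_ acc : ℕ) => (fun (E : ℕ) => @List.rec ℕ (fun _ => ℕ) 0 (fun (x : ℕ) (_ : List ℕ) (acc : ℕ) => Nat.lor acc (Nat.shiftLeft E x)) [0, a, b, c]) acc) k) (Nat.shiftLeft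 acc g)) 13) (Nat.div (@Nat.rec (fun _ => ℕ) 1 (fun (k acc : ℕ) => Nat.lor (@Nat.rec (fun _ => ℕ) ((fun (E : ℕ) => @List.rec ℕ (fun _ => ℕ) 0 (fun (x : ℕ) (_ : List ℕ) (acc : ℕ) => Nat.lor acc (Nat.shiftLeft E x)) [0, a, b, c]) 1) (fun (_ acc : ℕ) => (fun (E : ℕ) => @List.rec ℕ (fun _ => ℕ) 0 (fun (x : ℕ) (_ : List ℕ) (acc : ℕ) => Nat.lor acc (Nat.shiftLeft E x)) [0, a, b, c]) acc) k) (Nat.shiftLeft acc g)) 13) 2)) (2 ^ 1746)) (2 ^ 1746 - 1) = true := by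
    apply rawAlive_of_testBit (t := 1746)
    intro r hr
    rcases hchainP r (by omega) with ⟨t, ht, hcard, hsum⟩ | ⟨t, ht, hcard, hsum⟩
    · rw [← hsum]
      exact Or.inl (testBit_incMask2_of_multiset [0, a, b, c] g 13 t ht hcard)
    · rw [← hsum]
      exact Or.inr (testBit_incMask2_of_multiset [0, a, b, c] g 13 t ht hcard)
  have hbit : ∀ r, r ≤ 1748 →
      r ∈ (Finset.univ : Finset (Sym (Fin 5) 13)).image (fun s : Sym (Fin 5) 13 => ((s : Multiset (Fin 5)).map d).sum) →
      Nat.beq (Nat.mod (Nat.div (@Nat.rec (fun _ => ℕ) 1 (fun (k acc : ℕ) => Nat.lor (@Nat.rec (fun _ => ℕ) ((fun (E : ℕ) => @List.rec ℕ (fun _ => ℕ) 0 (fun (x : ℕ) (_ : List ℕ) (acc : ℕ) => Nat.lor acc (Nat.shiftLeft E x)) [0, a, b, c]) 1) (fun (_ acc : ℕ) => (fun (E : ℕ) => @List.rec ℕ (fun _ => ℕ) 0 (fun (x : ℕ) (_ : List ℕ) (acc : ℕ) => Nat.lor acc (Nat.shiftLeft E x)) [0, a, b, c]) acc) k) (Nat.shiftLeft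 acc g)) 13) (2 ^ r)) 2) 1 = true := by
    intro r hr hr'
    obtain ⟨t, ht, hcard, hsum⟩ := hsumP r hr hr'
    rw [rawBit_eq_true_iff', ← hsum]
    exact testBit_incMask2_of_multiset [0, a, b, c] g 13 t ht hcard
  have peel : ∀ (Z LO HI : ℕ), Z = 1 → LO ≤ b → b < HI →
      (@Nat.rec (fun _ => ℕ → Bool) (fun _ => true) (fun (_ : ℕ) (ih : ℕ → Bool) (a : ℕ) => cond ((Nat.ble (1746 + 2) a || Nat.beq (Nat.mod (Nat.div (Nat.lor (@Nat.rec (fun _ => ℕ) ((fun (E : ℕ) => @List.rec ℕ (fun _ => ℕ) 0 (fun (x : ℕ) (_ : List ℕ) (acc : ℕ) => Nat.lor acc (Nat.shiftLeft E x)) [0]) 1) (fun (_ acc : ℕ) => (fun (E : ℕ) => @List.rec ℕ (fun _ => ℕ) 0 (fun (x : ℕ) (_ : List ℕ) (acc : ℕ) => Nat.lor acc (Nat.shiftLeft E x)) [0]) acc) 12) (Nat.div (@Nat.rec (fun _ => ℕ) ((fun (E : ℕ) => @List.rec ℕ (fun _ => ℕ) 0 (fun (x : ℕ) (_ : List ℕ)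 (acc : ℕ) => Nat.lor acc (Nat.shiftLeft E x)) [0]) 1) (fun (_ acc : ℕ) => (fun (E : ℕ) => @List.rec ℕ (fun _ => ℕ) 0 (fun (x : ℕ) (_ : List ℕ) (acc : ℕ) => Nat.lor acc (Nat.shiftLeft E x)) [0]) acc) 12) 2)) (Nat.pow 2 (a - 2))) 2) 1)) (((@Nat.rec (fun _ => ℕ → Bool) (fun _ => true) (fun (_ : ℕ) (ih : ℕ → Bool) (b : ℕ) => cond ((Nat.ble (1746 + 2) b || Nat.beq (Nat.mod (Nat.div (Nat.lor (@Nat.rec (fun _ => ℕ) ((fun (E : ℕ) => @List.rec ℕ (fun _ => ℕ) 0 (fun (x : ℕ) (_ : List ℕ) (acc : ℕ) => Nat.lor acc (Nat.shiftLeft E x)) [0, a]) 1) (fun (_ acc : ℕ) => (fun (E : ℕ) => @List.rec ℕ (fun _ => ℕ) 0 (fun (x : ℕ) (_ : List ℕ) (acc : ℕ) => Nat.lor acc (Nat.shiftLeft E x)) [0, a]) acc) 12) (Nat.div (@Nat.rec (fun _ => ℕ) ((fun (E : ℕ) => @List.rec ℕ (fun _ => ℕ) 0 (fun (x : ℕ)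 (_ : List ℕ) (acc : ℕ) => Nat.lor acc (Nat.shiftLeft E x)) [0, a]) 1) (fun (_ acc : ℕ) => (fun (E : ℕ) => @List.rec ℕ (fun _ => ℕ) 0 (fun (x : ℕ) (_ : List ℕ) (acc : ℕ) => Nat.lor acc (Nat.shiftLeft E x)) [0, a]) acc) 12) 2)) (Nat.pow 2 (b - 2))) 2) 1)) (((@Nat.rec (fun _ => ℕ → Bool) (fun _ => true) (fun (_ : ℕ) (ih : ℕ → Bool) (c : ℕ) => cond ((Nat.ble (1746 + 2) c || Nat.beq (Nat.mod (Nat.div (Nat.lor (@Nat.rec (fun _ => ℕ) ((fun (E : ℕ) => @List.rec ℕ (fun _ => ℕ) 0 (fun (x : ℕ) (_ : List ℕ) (acc : ℕ) => Nat.lor acc (Nat.shiftLeft E x)) [0, a, b]) 1) (fun (_ acc : ℕ) => (fun (E : ℕ) => @List.rec ℕ (fun _ => ℕ) 0 (fun (x : ℕ) (_ : List ℕ) (acc : ℕ) => Nat.lor acc (Nat.shiftLeft E x)) [0, a, b]) acc) 12) (Nat.div (@Nat.rec (fun _ => ℕ) ((fun (E : ℕ) => @List.rec ℕ (fun _ =>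 ℕ) 0 (fun (x : ℕ) (_ : List ℕ) (acc : ℕ) => Nat.lor acc (Nat.shiftLeft E x)) [0, a, b]) 1) (fun (_ acc : ℕ) => (fun (E : ℕ) => @List.rec ℕ (fun _ => ℕ) 0 (fun (x : ℕ) (_ : List ℕ) (acc : ℕ) => Nat.lor acc (Nat.shiftLeft E x)) [0, a, b]) acc) 12) 2)) (Nat.pow 2 (c - 2))) 2) 1)) (((@Nat.rec (fun _ => ℕ → Bool) (fun _ => true) (fun (_ : ℕ) (ih : ℕ → Bool) (g : ℕ) => cond ((Nat.ble (1746 + 2) g || Nat.beq (Nat.mod (Nat.div (Nat.lor (@Nat.rec (fun _ => ℕ) ((fun (E : ℕ) => @List.rec ℕ (fun _ => ℕ) 0 (fun (x : ℕ) (_ : List ℕ) (acc : ℕ) => Nat.lor acc (Nat.shiftLeft E x)) [0, a, b, c]) 1) (fun (_ acc : ℕ) => (fun (E : ℕ) => @List.rec ℕ (fun _ => ℕ) 0 (fun (x : ℕ) (_ : List ℕ) (acc : ℕ) => Nat.lor acc (Nat.shiftLeft E x)) [0, a, b, c]) acc) 12) (Nat.div (@Nat.rec (fun _ => ℕ) ((fun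 (E : ℕ) => @List.rec ℕ (fun _ => ℕ) 0 (fun (x : ℕ) (_ : List ℕ) (acc : ℕ) => Nat.lor acc (Nat.shiftLeft E x)) [0, a, b, c]) 1) (fun (_ acc : ℕ) => (fun (E : ℕ) => @List.rec ℕ (fun _ => ℕ) 0 (fun (x : ℕ) (_ : List ℕ) (acc : ℕ) => Nat.lor acc (Nat.shiftLeft E x)) [0, a, b, c]) acc) 12) 2)) (Nat.pow 2 (g - 2))) 2) 1)) (((!(Nat.beq (Nat.mod (Nat.lor (@Nat.rec (fun _ => ℕ) 1 (fun (k acc : ℕ) => Nat.lor (@Nat.rec (fun _ => ℕ) ((fun (E : ℕ) => @List.rec ℕ (fun _ => ℕ) 0 (fun (x : ℕ) (_ : List ℕ) (acc : ℕ) => Nat.lor acc (Nat.shiftLeft E x)) [0, a, b, c]) 1) (fun (_ acc : ℕ) => (fun (E : ℕ) => @List.rec ℕ (fun _ => ℕ) 0 (fun (x : ℕ) (_ : List ℕ) (acc : ℕ) => Nat.lor acc (Nat.shiftLeft E x)) [0, a, b, c]) acc) k) (Nat.shiftLeft acc g)) 13) (Nat.div (@Nat.rec (fun _ => ℕ) 1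 (fun (k acc : ℕ) => Nat.lor (@Nat.rec (fun _ => ℕ) ((fun (E : ℕ) => @List.rec ℕ (fun _ => ℕ) 0 (fun (x : ℕ) (_ : List ℕ) (acc : ℕ) => Nat.lor acc (Nat.shiftLeft E x)) [0, a, b, c]) 1) (fun (_ acc : ℕ) => (fun (E : ℕ) => @List.rec ℕ (fun _ => ℕ) 0 (fun (x : ℕ) (_ : List ℕ) (acc : ℕ) => Nat.lor acc (Nat.shiftLeft E x)) [0, a, b, c]) acc) k) (Nat.shiftLeft acc g)) 13) 2)) (2 ^ 1746)) (2 ^ 1746 - 1)) || (!(Nat.beq (Nat.mod (Nat.div (@Nat.rec (fun _ => ℕ) 1 (fun (k acc : ℕ) => Nat.lor (@Nat.rec (fun _ => ℕ) ((fun (E : ℕ) => @List.rec ℕ (fun _ => ℕ) 0 (fun (x : ℕ) (_ : List ℕ) (acc : ℕ) => Nat.lor acc (Nat.shiftLeft E x)) [0, a, b, c]) 1) (fun (_ acc : ℕ) => (fun (E : ℕ) => @List.rec ℕ (fun _ => ℕ) 0 (fun (x : ℕ) (_ : List ℕ) (acc : ℕ) => Nat.lor acc (Nat.shiftLeft E x))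 [0, a, b, c]) acc) k) (Nat.shiftLeft acc g)) 13) (2 ^ 1747)) 2) 1) && (!(Nat.beq (Nat.mod (Nat.div (@Nat.rec (fun _ => ℕ) 1 (fun (k acc : ℕ) => Nat.lor (@Nat.rec (fun _ => ℕ) ((fun (E : ℕ) => @List.rec ℕ (fun _ => ℕ) 0 (fun (x : ℕ) (_ : List ℕ) (acc : ℕ) => Nat.lor acc (Nat.shiftLeft E x)) [0, a, b, c]) 1) (fun (_ acc : ℕ) => (fun (E : ℕ) => @List.rec ℕ (fun _ => ℕ) 0 (fun (x : ℕ) (_ : List ℕ) (acc : ℕ) => Nat.lor acc (Nat.shiftLeft E x)) [0, a, b, c]) acc) k) (Nat.shiftLeft acc g)) 13) (2 ^ 1746)) 2) 1) || !(Nat.beq (Nat.mod (Nat.div (@Nat.rec (fun _ => ℕ) 1 (fun (k acc : ℕ) => Nat.lor (@Nat.rec (fun _ => ℕ) ((fun (E : ℕ) => @List.rec ℕ (fun _ => ℕ) 0 (fun (x : ℕ) (_ : List ℕ) (acc : ℕ) => Nat.lor acc (Nat.shiftLeft E x)) [0, a, b, c]) 1) (fun (_ acc : ℕ) => (fun (E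 : ℕ) => @List.rec ℕ (fun _ => ℕ) 0 (fun (x : ℕ) (_ : List ℕ) (acc : ℕ) => Nat.lor acc (Nat.shiftLeft E x)) [0, a, b, c]) acc) k) (Nat.shiftLeft acc g)) 13) (2 ^ 1748)) 2) 1))))) && ih (g + 1)) true) (1750 - (c + 1)) (c + 1))) && ih (c + 1)) true) (1750 - (b + 1)) (b + 1))) && ih (b + 1)) true) ((HI - ((a + 1) + (LO - (a + 1))))) (((a + 1) + (LO - (a + 1)))))) && ih (a + 1)) true) (1750 - (Z)) (Z)) = true → False := by
    intro Z LO HI hZ hLO hHI W0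
    have W1 := walk_true (p := fun (a : ℕ) => (Nat.ble (1746 + 2) a || Nat.beq (Nat.mod (Nat.div (Nat.lor (@Nat.rec (fun _ => ℕ) ((fun (E : ℕ) => @List.rec ℕ (fun _ => ℕ) 0 (fun (x : ℕ) (_ : List ℕ) (acc : ℕ) => Nat.lor acc (Nat.shiftLeft E x)) [0]) 1) (fun (_ acc : ℕ) => (fun (E : ℕ) => @List.rec ℕ (fun _ => ℕ) 0 (fun (x : ℕ) (_ : List ℕ) (acc : ℕ) => Nat.lor acc (Nat.shiftLeft E x)) [0]) acc) 12) (Nat.div (@Nat.rec (fun _ => ℕ) ((fun (E : ℕ) => @List.rec ℕ (fun _ => ℕ) 0 (fun (x : ℕ) (_ : List ℕ) (acc : ℕ) => Nat.lor acc (Nat.shiftLeft E x)) [0]) 1) (fun (_ acc : ℕ) => (fun (E : ℕ) => @List.rec ℕ (fun _ => ℕ) 0 (fun (x : ℕ) (_ : List ℕ) (acc : ℕ) => Nat.lor acc (Nat.shiftLeft E x)) [0]) acc) 12) 2)) (Nat.pow 2 (a - 2))) 2) 1)) (q := fun (a : ℕ) => (@Nat.rec (fun _ => ℕ → Bool) (fun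 _ => true) (fun (_ : ℕ) (ih : ℕ → Bool) (b : ℕ) => cond ((Nat.ble (1746 + 2) b || Nat.beq (Nat.mod (Nat.div (Nat.lor (@Nat.rec (fun _ => ℕ) ((fun (E : ℕ) => @List.rec ℕ (fun _ => ℕ) 0 (fun (x : ℕ) (_ : List ℕ) (acc : ℕ) => Nat.lor acc (Nat.shiftLeft E x)) [0, a]) 1) (fun (_ acc : ℕ) => (fun (E : ℕ) => @List.rec ℕ (fun _ => ℕ) 0 (fun (x : ℕ) (_ : List ℕ) (acc : ℕ) => Nat.lor acc (Nat.shiftLeft E x)) [0, a]) acc) 12) (Nat.div (@Nat.rec (fun _ => ℕ) ((fun (E : ℕ) => @List.rec ℕ (fun _ => ℕ) 0 (fun (x : ℕ) (_ : List ℕ) (acc : ℕ) => Nat.lor acc (Nat.shiftLeft E x)) [0, a]) 1) (fun (_ acc : ℕ) => (fun (E : ℕ) => @List.rec ℕ (fun _ => ℕ) 0 (fun (x : ℕ) (_ : List ℕ) (acc : ℕ) => Nat.lor acc (Nat.shiftLeft E x)) [0, a]) acc) 12) 2)) (Nat.pow 2 (b - 2))) 2) 1)) (((@Nat.rec (fun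 _ => ℕ → Bool) (fun _ => true) (fun (_ : ℕ) (ih : ℕ → Bool) (c : ℕ) => cond ((Nat.ble (1746 + 2) c || Nat.beq (Nat.mod (Nat.div (Nat.lor (@Nat.rec (fun _ => ℕ) ((fun (E : ℕ) => @List.rec ℕ (fun _ => ℕ) 0 (fun (x : ℕ) (_ : List ℕ) (acc : ℕ) => Nat.lor acc (Nat.shiftLeft E x)) [0, a, b]) 1) (fun (_ acc : ℕ) => (fun (E : ℕ) => @List.rec ℕ (fun _ => ℕ) 0 (fun (x : ℕ) (_ : List ℕ) (acc : ℕ) => Nat.lor acc (Nat.shiftLeft E x)) [0, a, b]) acc) 12) (Nat.div (@Nat.rec (fun _ => ℕ) ((fun (E : ℕ) => @List.rec ℕ (fun _ => ℕ) 0 (fun (x : ℕ) (_ : List ℕ) (acc : ℕ) => Nat.lor acc (Nat.shiftLeft E x)) [0, a, b]) 1) (fun (_ acc : ℕ) => (fun (E : ℕ) => @List.rec ℕ (fun _ => ℕ) 0 (fun (x : ℕ) (_ : List ℕ) (acc : ℕ) => Nat.lor acc (Nat.shiftLeft E x)) [0, a, b]) acc) 12) 2)) (Nat.pow 2 (c -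 2))) 2) 1)) (((@Nat.rec (fun _ => ℕ → Bool) (fun _ => true) (fun (_ : ℕ) (ih : ℕ → Bool) (g : ℕ) => cond ((Nat.ble (1746 + 2) g || Nat.beq (Nat.mod (Nat.div (Nat.lor (@Nat.rec (fun _ => ℕ) ((fun (E : ℕ) => @List.rec ℕ (fun _ => ℕ) 0 (fun (x : ℕ) (_ : List ℕ) (acc : ℕ) => Nat.lor acc (Nat.shiftLeft E x)) [0, a, b, c]) 1) (fun (_ acc : ℕ) => (fun (E : ℕ) => @List.rec ℕ (fun _ => ℕ) 0 (fun (x : ℕ) (_ : List ℕ) (acc : ℕ) => Nat.lor acc (Nat.shiftLeft E x)) [0, a, b, c]) acc) 12) (Nat.div (@Nat.rec (fun _ => ℕ) ((fun (E : ℕ) => @List.rec ℕ (fun _ => ℕ) 0 (fun (x : ℕ) (_ : List ℕ) (acc : ℕ) => Nat.lor acc (Nat.shiftLeft E x)) [0, a, b, c]) 1) (fun (_ acc : ℕ) => (fun (E : ℕ) => @List.rec ℕ (fun _ => ℕ) 0 (fun (x : ℕ) (_ : List ℕ) (acc : ℕ) => Nat.lor acc (Nat.shiftLeft E x)) [0,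 a, b, c]) acc) 12) 2)) (Nat.pow 2 (g - 2))) 2) 1)) (((!(Nat.beq (Nat.mod (Nat.lor (@Nat.rec (fun _ => ℕ) 1 (fun (k acc : ℕ) => Nat.lor (@Nat.rec (fun _ => ℕ) ((fun (E : ℕ) => @List.rec ℕ (fun _ => ℕ) 0 (fun (x : ℕ) (_ : List ℕ) (acc : ℕ) => Nat.lor acc (Nat.shiftLeft E x)) [0, a, b, c]) 1) (fun (_ acc : ℕ) => (fun (E : ℕ) => @List.rec ℕ (fun _ => ℕ) 0 (fun (x : ℕ) (_ : List ℕ) (acc : ℕ) => Nat.lor acc (Nat.shiftLeft E x)) [0, a, b, c]) acc) k) (Nat.shiftLeft acc g)) 13) (Nat.div (@Nat.rec (fun _ => ℕ) 1 (fun (k acc : ℕ) => Nat.lor (@Nat.rec (fun _ => ℕ) ((fun (E : ℕ) => @List.rec ℕ (fun _ => ℕ) 0 (fun (x : ℕ) (_ : List ℕ) (acc : ℕ) => Nat.lor acc (Nat.shiftLeft E x)) [0, a, b, c]) 1) (fun (_ acc : ℕ) => (fun (E : ℕ) => @List.rec ℕ (fun _ => ℕ) 0 (fun (x : ℕ) (_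 : List ℕ) (acc : ℕ) => Nat.lor acc (Nat.shiftLeft E x)) [0, a, b, c]) acc) k) (Nat.shiftLeft acc g)) 13) 2)) (2 ^ 1746)) (2 ^ 1746 - 1)) || (!(Nat.beq (Nat.mod (Nat.div (@Nat.rec (fun _ => ℕ) 1 (fun (k acc : ℕ) => Nat.lor (@Nat.rec (fun _ => ℕ) ((fun (E : ℕ) => @List.rec ℕ (fun _ => ℕ) 0 (fun (x : ℕ) (_ : List ℕ) (acc : ℕ) => Nat.lor acc (Nat.shiftLeft E x)) [0, a, b, c]) 1) (fun (_ acc : ℕ) => (fun (E : ℕ) => @List.rec ℕ (fun _ => ℕ) 0 (fun (x : ℕ) (_ : List ℕ) (acc : ℕ) => Nat.lor acc (Nat.shiftLeft E x)) [0, a, b, c]) acc) k) (Nat.shiftLeft acc g)) 13) (2 ^ 1747)) 2) 1) && (!(Nat.beq (Nat.mod (Nat.div (@Nat.rec (fun _ => ℕ) 1 (fun (k acc : ℕ) => Nat.lor (@Nat.rec (fun _ => ℕ) ((fun (E : ℕ) => @List.rec ℕ (fun _ => ℕ) 0 (fun (x : ℕ) (_ : List ℕ) (acc : ℕ) => Nat.lor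 acc (Nat.shiftLeft E x)) [0, a, b, c]) 1) (fun (_ acc : ℕ) => (fun (E : ℕ) => @List.rec ℕ (fun _ => ℕ) 0 (fun (x : ℕ) (_ : List ℕ) (acc : ℕ) => Nat.lor acc (Nat.shiftLeft E x)) [0, a, b, c]) acc) k) (Nat.shiftLeft acc g)) 13) (2 ^ 1746)) 2) 1) || !(Nat.beq (Nat.mod (Nat.div (@Nat.rec (fun _ => ℕ) 1 (fun (k acc : ℕ) => Nat.lor (@Nat.rec (fun _ => ℕ) ((fun (E : ℕ) => @List.rec ℕ (fun _ => ℕ) 0 (fun (x : ℕ) (_ : List ℕ) (acc : ℕ) => Nat.lor acc (Nat.shiftLeft E x)) [0, a, b, c]) 1) (fun (_ acc : ℕ) => (fun (E : ℕ) => @List.rec ℕ (fun _ => ℕ) 0 (fun (x : ℕ) (_ : List ℕ) (acc : ℕ) => Nat.lor acc (Nat.shiftLeft E x)) [0, a, b, c]) acc) k) (Nat.shiftLeft acc g)) 13) (2 ^ 1748)) 2) 1))))) && ih (g + 1)) true) (1750 - (c + 1)) (c + 1))) && ih (c + 1)) true) (1750 - (b + 1)) (b + 1))) && ih (b + 1))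 true) ((HI - ((a + 1) + (LO - (a + 1))))) (((a + 1) + (LO - (a + 1)))))) (1750 - (Z)) (Z) a (by omega) (by omega) (fun c' h1 h2 => hg0 c' (by omega) h2) W0
    have W2 := walk_true (p := fun (b : ℕ) => (Nat.ble (1746 + 2) b || Nat.beq (Nat.mod (Nat.div (Nat.lor (@Nat.rec (fun _ => ℕ) ((fun (E : ℕ) => @List.rec ℕ (fun _ => ℕ) 0 (fun (x : ℕ) (_ : List ℕ) (acc : ℕ) => Nat.lor acc (Nat.shiftLeft E x)) [0, a]) 1) (fun (_ acc : ℕ) => (fun (E : ℕ) => @List.rec ℕ (fun _ => ℕ) 0 (fun (x : ℕ) (_ : List ℕ) (acc : ℕ) => Nat.lor acc (Nat.shiftLeft E x)) [0, a]) acc) 12) (Nat.div (@Nat.rec (fun _ => ℕ) ((fun (E : ℕ) => @List.rec ℕ (fun _ => ℕ) 0 (fun (x : ℕ) (_ : List ℕ) (acc : ℕ) => Nat.lor acc (Nat.shiftLeft E x)) [0, a]) 1) (fun (_ acc : ℕ) => (fun (E : ℕ) => @List.rec ℕ (fun _ => ℕ) 0 (fun (x : ℕ) (_ : List ℕ) (acc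 : ℕ) => Nat.lor acc (Nat.shiftLeft E x)) [0, a]) acc) 12) 2)) (Nat.pow 2 (b - 2))) 2) 1)) (q := fun (b : ℕ) => (@Nat.rec (fun _ => ℕ → Bool) (fun _ => true) (fun (_ : ℕ) (ih : ℕ → Bool) (c : ℕ) => cond ((Nat.ble (1746 + 2) c || Nat.beq (Nat.mod (Nat.div (Nat.lor (@Nat.rec (fun _ => ℕ) ((fun (E : ℕ) => @List.rec ℕ (fun _ => ℕ) 0 (fun (x : ℕ) (_ : List ℕ) (acc : ℕ) => Nat.lor acc (Nat.shiftLeft E x)) [0, a, b]) 1) (fun (_ acc : ℕ) => (fun (E : ℕ) => @List.rec ℕ (fun _ => ℕ) 0 (fun (x : ℕ) (_ : List ℕ) (acc : ℕ) => Nat.lor acc (Nat.shiftLeft E x)) [0, a, b]) acc) 12) (Nat.div (@Nat.rec (fun _ => ℕ) ((fun (E : ℕ) => @List.rec ℕ (fun _ => ℕ) 0 (fun (x : ℕ) (_ : List ℕ) (acc : ℕ) => Nat.lor acc (Nat.shiftLeft E x)) [0, a, b]) 1) (fun (_ acc : ℕ) => (fun (E : ℕ) => @List.rec ℕ (fun _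 => ℕ) 0 (fun (x : ℕ) (_ : List ℕ) (acc : ℕ) => Nat.lor acc (Nat.shiftLeft E x)) [0, a, b]) acc) 12) 2)) (Nat.pow 2 (c - 2))) 2) 1)) (((@Nat.rec (fun _ => ℕ → Bool) (fun _ => true) (fun (_ : ℕ) (ih : ℕ → Bool) (g : ℕ) => cond ((Nat.ble (1746 + 2) g || Nat.beq (Nat.mod (Nat.div (Nat.lor (@Nat.rec (fun _ => ℕ) ((fun (E : ℕ) => @List.rec ℕ (fun _ => ℕ) 0 (fun (x : ℕ) (_ : List ℕ) (acc : ℕ) => Nat.lor acc (Nat.shiftLeft E x)) [0, a, b, c]) 1) (fun (_ acc : ℕ) => (fun (E : ℕ) => @List.rec ℕ (fun _ => ℕ) 0 (fun (x : ℕ) (_ : List ℕ) (acc : ℕ) => Nat.lor acc (Nat.shiftLeft E x)) [0, a, b, c]) acc) 12) (Nat.div (@Nat.rec (fun _ => ℕ) ((fun (E : ℕ) => @List.rec ℕ (fun _ => ℕ) 0 (fun (x : ℕ) (_ : List ℕ) (acc : ℕ) => Nat.lor acc (Nat.shiftLeft E x)) [0, a, b, c]) 1) (fun (_ acc : ℕ)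 => (fun (E : ℕ) => @List.rec ℕ (fun _ => ℕ) 0 (fun (x : ℕ) (_ : List ℕ) (acc : ℕ) => Nat.lor acc (Nat.shiftLeft E x)) [0, a, b, c]) acc) 12) 2)) (Nat.pow 2 (g - 2))) 2) 1)) (((!(Nat.beq (Nat.mod (Nat.lor (@Nat.rec (fun _ => ℕ) 1 (fun (k acc : ℕ) => Nat.lor (@Nat.rec (fun _ => ℕ) ((fun (E : ℕ) => @List.rec ℕ (fun _ => ℕ) 0 (fun (x : ℕ) (_ : List ℕ) (acc : ℕ) => Nat.lor acc (Nat.shiftLeft E x)) [0, a, b, c]) 1) (fun (_ acc : ℕ) => (fun (E : ℕ) => @List.rec ℕ (fun _ => ℕ) 0 (fun (x : ℕ) (_ : List ℕ) (acc : ℕ) => Nat.lor acc (Nat.shiftLeft E x)) [0, a, b, c]) acc) k) (Nat.shiftLeft acc g)) 13) (Nat.div (@Nat.rec (fun _ => ℕ) 1 (fun (k acc : ℕ) => Nat.lor (@Nat.rec (fun _ => ℕ) ((fun (E : ℕ) => @List.rec ℕ (fun _ => ℕ) 0 (fun (x : ℕ) (_ : List ℕ) (acc : ℕ) => Nat.lor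 acc (Nat.shiftLeft E x)) [0, a, b, c]) 1) (fun (_ acc : ℕ) => (fun (E : ℕ) => @List.rec ℕ (fun _ => ℕ) 0 (fun (x : ℕ) (_ : List ℕ) (acc : ℕ) => Nat.lor acc (Nat.shiftLeft E x)) [0, a, b, c]) acc) k) (Nat.shiftLeft acc g)) 13) 2)) (2 ^ 1746)) (2 ^ 1746 - 1)) || (!(Nat.beq (Nat.mod (Nat.div (@Nat.rec (fun _ => ℕ) 1 (fun (k acc : ℕ) => Nat.lor (@Nat.rec (fun _ => ℕ) ((fun (E : ℕ) => @List.rec ℕ (fun _ => ℕ) 0 (fun (x : ℕ) (_ : List ℕ) (acc : ℕ) => Nat.lor acc (Nat.shiftLeft E x)) [0, a, b, c]) 1) (fun (_ acc : ℕ) => (fun (E : ℕ) => @List.rec ℕ (fun _ => ℕ) 0 (fun (x : ℕ) (_ : List ℕ) (acc : ℕ) => Nat.lor acc (Nat.shiftLeft E x)) [0, a, b, c]) acc) k) (Nat.shiftLeft acc g)) 13) (2 ^ 1747)) 2) 1) && (!(Nat.beq (Nat.mod (Nat.div (@Nat.rec (fun _ => ℕ) 1 (fun (k acc : ℕ) =>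 Nat.lor (@Nat.rec (fun _ => ℕ) ((fun (E : ℕ) => @List.rec ℕ (fun _ => ℕ) 0 (fun (x : ℕ) (_ : List ℕ) (acc : ℕ) => Nat.lor acc (Nat.shiftLeft E x)) [0, a, b, c]) 1) (fun (_ acc : ℕ) => (fun (E : ℕ) => @List.rec ℕ (fun _ => ℕ) 0 (fun (x : ℕ) (_ : List ℕ) (acc : ℕ) => Nat.lor acc (Nat.shiftLeft E x)) [0, a, b, c]) acc) k) (Nat.shiftLeft acc g)) 13) (2 ^ 1746)) 2) 1) || !(Nat.beq (Nat.mod (Nat.div (@Nat.rec (fun _ => ℕ) 1 (fun (k acc : ℕ) => Nat.lor (@Nat.rec (fun _ => ℕ) ((fun (E : ℕ) => @List.rec ℕ (fun _ => ℕ) 0 (fun (x : ℕ) (_ : List ℕ) (acc : ℕ) => Nat.lor acc (Nat.shiftLeft E x)) [0, a, b, c]) 1) (fun (_ acc : ℕ) => (fun (E : ℕ) => @List.rec ℕ (fun _ => ℕ) 0 (fun (x : ℕ) (_ : List ℕ) (acc : ℕ) => Nat.lor acc (Nat.shiftLeft E x)) [0, a, b, c]) acc) k) (Nat.shiftLeft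 acc g)) 13) (2 ^ 1748)) 2) 1))))) && ih (g + 1)) true) (1750 - (c + 1)) (c + 1))) && ih (c + 1)) true) (1750 - (b + 1)) (b + 1))) ((HI - ((a + 1) + (LO - (a + 1))))) (((a + 1) + (LO - (a + 1)))) b (by omega) (by omega) (fun c' h1 h2 => hg1 c' (by omega) h2) W1
    have W3 := walk_true (p := fun (c : ℕ) => (Nat.ble (1746 + 2) c || Nat.beq (Nat.mod (Nat.div (Nat.lor (@Nat.rec (fun _ => ℕ) ((fun (E : ℕ) => @List.rec ℕ (fun _ => ℕ) 0 (fun (x : ℕ) (_ : List ℕ) (acc : ℕ) => Nat.lor acc (Nat.shiftLeft E x)) [0, a, b]) 1) (fun (_ acc : ℕ) => (fun (E : ℕ) => @List.rec ℕ (fun _ => ℕ) 0 (fun (x : ℕ) (_ : List ℕ) (acc : ℕ) => Nat.lor acc (Nat.shiftLeft E x)) [0, a, b]) acc) 12) (Nat.div (@Nat.rec (fun _ => ℕ) ((fun (E : ℕ) => @List.rec ℕ (fun _ => ℕ) 0 (fun (x : ℕ) (_ : List ℕ) (acc : ℕ) => Nat.lor acc (Nat.shiftLeft E x)) [0, a,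 b]) 1) (fun (_ acc : ℕ) => (fun (E : ℕ) => @List.rec ℕ (fun _ => ℕ) 0 (fun (x : ℕ) (_ : List ℕ) (acc : ℕ) => Nat.lor acc (Nat.shiftLeft E x)) [0, a, b]) acc) 12) 2)) (Nat.pow 2 (c - 2))) 2) 1)) (q := fun (c : ℕ) => (@Nat.rec (fun _ => ℕ → Bool) (fun _ => true) (fun (_ : ℕ) (ih : ℕ → Bool) (g : ℕ) => cond ((Nat.ble (1746 + 2) g || Nat.beq (Nat.mod (Nat.div (Nat.lor (@Nat.rec (fun _ => ℕ) ((fun (E : ℕ) => @List.rec ℕ (fun _ => ℕ) 0 (fun (x : ℕ) (_ : List ℕ) (acc : ℕ) => Nat.lor acc (Nat.shiftLeft E x)) [0, a, b, c]) 1) (fun (_ acc : ℕ) => (fun (E : ℕ) => @List.rec ℕ (fun _ => ℕ) 0 (fun (x : ℕ) (_ : List ℕ) (acc : ℕ) => Nat.lor acc (Nat.shiftLeft E x)) [0, a, b, c]) acc) 12) (Nat.div (@Nat.rec (fun _ => ℕ) ((fun (E : ℕ) => @List.rec ℕ (fun _ => ℕ) 0 (fun (x : ℕ) (_ : List ℕ)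 (acc : ℕ) => Nat.lor acc (Nat.shiftLeft E x)) [0, a, b, c]) 1) (fun (_ acc : ℕ) => (fun (E : ℕ) => @List.rec ℕ (fun _ => ℕ) 0 (fun (x : ℕ) (_ : List ℕ) (acc : ℕ) => Nat.lor acc (Nat.shiftLeft E x)) [0, a, b, c]) acc) 12) 2)) (Nat.pow 2 (g - 2))) 2) 1)) (((!(Nat.beq (Nat.mod (Nat.lor (@Nat.rec (fun _ => ℕ) 1 (fun (k acc : ℕ) => Nat.lor (@Nat.rec (fun _ => ℕ) ((fun (E : ℕ) => @List.rec ℕ (fun _ => ℕ) 0 (fun (x : ℕ) (_ : List ℕ) (acc : ℕ) => Nat.lor acc (Nat.shiftLeft E x)) [0, a, b, c]) 1) (fun (_ acc : ℕ) => (fun (E : ℕ) => @List.rec ℕ (fun _ => ℕ) 0 (fun (x : ℕ) (_ : List ℕ) (acc : ℕ) => Nat.lor acc (Nat.shiftLeft E x)) [0, a, b, c]) acc) k) (Nat.shiftLeft acc g)) 13) (Nat.div (@Nat.rec (fun _ => ℕ) 1 (fun (k acc : ℕ) => Nat.lor (@Nat.rec (fun _ => ℕ) ((fun (E : ℕ)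 => @List.rec ℕ (fun _ => ℕ) 0 (fun (x : ℕ) (_ : List ℕ) (acc : ℕ) => Nat.lor acc (Nat.shiftLeft E x)) [0, a, b, c]) 1) (fun (_ acc : ℕ) => (fun (E : ℕ) => @List.rec ℕ (fun _ => ℕ) 0 (fun (x : ℕ) (_ : List ℕ) (acc : ℕ) => Nat.lor acc (Nat.shiftLeft E x)) [0, a, b, c]) acc) k) (Nat.shiftLeft acc g)) 13) 2)) (2 ^ 1746)) (2 ^ 1746 - 1)) || (!(Nat.beq (Nat.mod (Nat.div (@Nat.rec (fun _ => ℕ) 1 (fun (k acc : ℕ) => Nat.lor (@Nat.rec (fun _ => ℕ) ((fun (E : ℕ) => @List.rec ℕ (fun _ => ℕ) 0 (fun (x : ℕ) (_ : List ℕ) (acc : ℕ) => Nat.lor acc (Nat.shiftLeft E x)) [0, a, b, c]) 1) (fun (_ acc : ℕ) => (fun (E : ℕ) => @List.rec ℕ (fun _ => ℕ) 0 (fun (x : ℕ) (_ : List ℕ) (acc : ℕ) => Nat.lor acc (Nat.shiftLeft E x)) [0, a, b, c]) acc) k) (Nat.shiftLeft acc g)) 13) (2 ^ 1747)) 2) 1)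 && (!(Nat.beq (Nat.mod (Nat.div (@Nat.rec (fun _ => ℕ) 1 (fun (k acc : ℕ) => Nat.lor (@Nat.rec (fun _ => ℕ) ((fun (E : ℕ) => @List.rec ℕ (fun _ => ℕ) 0 (fun (x : ℕ) (_ : List ℕ) (acc : ℕ) => Nat.lor acc (Nat.shiftLeft E x)) [0, a, b, c]) 1) (fun (_ acc : ℕ) => (fun (E : ℕ) => @List.rec ℕ (fun _ => ℕ) 0 (fun (x : ℕ) (_ : List ℕ) (acc : ℕ) => Nat.lor acc (Nat.shiftLeft E x)) [0, a, b, c]) acc) k) (Nat.shiftLeft acc g)) 13) (2 ^ 1746)) 2) 1) || !(Nat.beq (Nat.mod (Nat.div (@Nat.rec (fun _ => ℕ) 1 (fun (k acc : ℕ) => Nat.lor (@Nat.rec (fun _ => ℕ) ((fun (E : ℕ) => @List.rec ℕ (fun _ => ℕ) 0 (fun (x : ℕ) (_ : List ℕ) (acc : ℕ) => Nat.lor acc (Nat.shiftLeft E x)) [0, a, b, c]) 1) (fun (_ acc : ℕ) => (fun (E : ℕ) => @List.rec ℕ (fun _ => ℕ) 0 (fun (x : ℕ) (_ : List ℕ)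 (acc : ℕ) => Nat.lor acc (Nat.shiftLeft E x)) [0, a, b, c]) acc) k) (Nat.shiftLeft acc g)) 13) (2 ^ 1748)) 2) 1))))) && ih (g + 1)) true) (1750 - (c + 1)) (c + 1))) (1750 - (b + 1)) (b + 1) c (by omega) (by omega) (fun c' h1 h2 => hg2 c' (by omega) h2) W2
    have W4 := walk_true (p := fun (g : ℕ) => (Nat.ble (1746 + 2) g || Nat.beq (Nat.mod (Nat.div (Nat.lor (@Nat.rec (fun _ => ℕ) ((fun (E : ℕ) => @List.rec ℕ (fun _ => ℕ) 0 (fun (x : ℕ) (_ : List ℕ) (acc : ℕ) => Nat.lor acc (Nat.shiftLeft E x)) [0, a, b, c]) 1) (fun (_ acc : ℕ) => (fun (E : ℕ) => @List.rec ℕ (fun _ => ℕ) 0 (fun (x : ℕ) (_ : List ℕ) (acc : ℕ) => Nat.lor acc (Nat.shiftLeft E x)) [0, a, b, c]) acc) 12) (Nat.div (@Nat.rec (fun _ => ℕ) ((fun (E : ℕ) => @List.rec ℕ (fun _ => ℕ) 0 (fun (x : ℕ) (_ : List ℕ) (acc : ℕ) => Nat.lor acc (Nat.shiftLeft E x)) [0,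 a, b, c]) 1) (fun (_ acc : ℕ) => (fun (E : ℕ) => @List.rec ℕ (fun _ => ℕ) 0 (fun (x : ℕ) (_ : List ℕ) (acc : ℕ) => Nat.lor acc (Nat.shiftLeft E x)) [0, a, b, c]) acc) 12) 2)) (Nat.pow 2 (g - 2))) 2) 1)) (q := fun (g : ℕ) => (!(Nat.beq (Nat.mod (Nat.lor (@Nat.rec (fun _ => ℕ) 1 (fun (k acc : ℕ) => Nat.lor (@Nat.rec (fun _ => ℕ) ((fun (E : ℕ) => @List.rec ℕ (fun _ => ℕ) 0 (fun (x : ℕ) (_ : List ℕ) (acc : ℕ) => Nat.lor acc (Nat.shiftLeft E x)) [0, a, b, c]) 1) (fun (_ acc : ℕ) => (fun (E : ℕ) => @List.rec ℕ (fun _ => ℕ) 0 (fun (x : ℕ) (_ : List ℕ) (acc : ℕ) => Nat.lor acc (Nat.shiftLeft E x)) [0, a, b, c]) acc) k) (Nat.shiftLeft acc g)) 13) (Nat.div (@Nat.rec (fun _ => ℕ) 1 (fun (k acc : ℕ) => Nat.lor (@Nat.rec (fun _ => ℕ) ((fun (E : ℕ) => @List.rec ℕ (fun _ => ℕ) 0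 (fun (x : ℕ) (_ : List ℕ) (acc : ℕ) => Nat.lor acc (Nat.shiftLeft E x)) [0, a, b, c]) 1) (fun (_ acc : ℕ) => (fun (E : ℕ) => @List.rec ℕ (fun _ => ℕ) 0 (fun (x : ℕ) (_ : List ℕ) (acc : ℕ) => Nat.lor acc (Nat.shiftLeft E x)) [0, a, b, c]) acc) k) (Nat.shiftLeft acc g)) 13) 2)) (2 ^ 1746)) (2 ^ 1746 - 1)) || (!(Nat.beq (Nat.mod (Nat.div (@Nat.rec (fun _ => ℕ) 1 (fun (k acc : ℕ) => Nat.lor (@Nat.rec (fun _ => ℕ) ((fun (E : ℕ) => @List.rec ℕ (fun _ => ℕ) 0 (fun (x : ℕ) (_ : List ℕ) (acc : ℕ) => Nat.lor acc (Nat.shiftLeft E x)) [0, a, b, c]) 1) (fun (_ acc : ℕ) => (fun (E : ℕ) => @List.rec ℕ (fun _ => ℕ) 0 (fun (x : ℕ) (_ : List ℕ) (acc : ℕ) => Nat.lor acc (Nat.shiftLeft E x)) [0, a, b, c]) acc) k) (Nat.shiftLeft acc g)) 13) (2 ^ 1747)) 2) 1) && (!(Nat.beq (Nat.mod (Nat.div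 (@Nat.rec (fun _ => ℕ) 1 (fun (k acc : ℕ) => Nat.lor (@Nat.rec (fun _ => ℕ) ((fun (E : ℕ) => @List.rec ℕ (fun _ => ℕ) 0 (fun (x : ℕ) (_ : List ℕ) (acc : ℕ) => Nat.lor acc (Nat.shiftLeft E x)) [0, a, b, c]) 1) (fun (_ acc : ℕ) => (fun (E : ℕ) => @List.rec ℕ (fun _ => ℕ) 0 (fun (x : ℕ) (_ : List ℕ) (acc : ℕ) => Nat.lor acc (Nat.shiftLeft E x)) [0, a, b, c]) acc) k) (Nat.shiftLeft acc g)) 13) (2 ^ 1746)) 2) 1) || !(Nat.beq (Nat.mod (Nat.div (@Nat.rec (fun _ => ℕ) 1 (fun (k acc : ℕ) => Nat.lor (@Nat.rec (fun _ => ℕ) ((fun (E : ℕ) => @List.rec ℕ (fun _ => ℕ) 0 (fun (x : ℕ) (_ : List ℕ) (acc : ℕ) => Nat.lor acc (Nat.shiftLeft E x)) [0, a, b, c]) 1) (fun (_ acc : ℕ) => (fun (E : ℕ) => @List.rec ℕ (fun _ => ℕ) 0 (fun (x : ℕ) (_ : List ℕ) (acc : ℕ) => Nat.lor acc (Nat.shiftLeft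 E x)) [0, a, b, c]) acc) k) (Nat.shiftLeft acc g)) 13) (2 ^ 1748)) 2) 1))))) (1750 - (c + 1)) (c + 1) g (by omega) (by omega) (fun c' h1 h2 => hg3 c' (by omega) h2) W3
    have WL : ((!(Nat.beq (Nat.mod (Nat.lor (@Nat.rec (fun _ => ℕ) 1 (fun (k acc : ℕ) => Nat.lor (@Nat.rec (fun _ => ℕ) ((fun (E : ℕ) => @List.rec ℕ (fun _ => ℕ) 0 (fun (x : ℕ) (_ : List ℕ) (acc : ℕ) => Nat.lor acc (Nat.shiftLeft E x)) [0, a, b, c]) 1) (fun (_ acc : ℕ) => (fun (E : ℕ) => @List.rec ℕ (fun _ => ℕ) 0 (fun (x : ℕ) (_ : List ℕ) (acc : ℕ) => Nat.lor acc (Nat.shiftLeft E x)) [0, a, b, c]) acc) k) (Nat.shiftLeft acc g)) 13) (Nat.div (@Nat.rec (fun _ => ℕ) 1 (fun (k acc : ℕ) => Nat.lor (@Nat.rec (fun _ => ℕ) ((fun (E : ℕ) => @List.rec ℕ (fun _ => ℕ) 0 (fun (x : ℕ) (_ : List ℕ) (acc : ℕ) => Nat.lor acc (Nat.shiftLeft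 E x)) [0, a, b, c]) 1) (fun (_ acc : ℕ) => (fun (E : ℕ) => @List.rec ℕ (fun _ => ℕ) 0 (fun (x : ℕ) (_ : List ℕ) (acc : ℕ) => Nat.lor acc (Nat.shiftLeft E x)) [0, a, b, c]) acc) k) (Nat.shiftLeft acc g)) 13) 2)) (2 ^ 1746)) (2 ^ 1746 - 1)) || (!(Nat.beq (Nat.mod (Nat.div (@Nat.rec (fun _ => ℕ) 1 (fun (k acc : ℕ) => Nat.lor (@Nat.rec (fun _ => ℕ) ((fun (E : ℕ) => @List.rec ℕ (fun _ => ℕ) 0 (fun (x : ℕ) (_ : List ℕ) (acc : ℕ) => Nat.lor acc (Nat.shiftLeft E x)) [0, a, b, c]) 1) (fun (_ acc : ℕ) => (fun (E : ℕ) => @List.rec ℕ (fun _ => ℕ) 0 (fun (x : ℕ) (_ : List ℕ) (acc : ℕ) => Nat.lor acc (Nat.shiftLeft E x)) [0, a, b, c]) acc) k) (Nat.shiftLeft acc g)) 13) (2 ^ 1747)) 2) 1) && (!(Nat.beq (Nat.mod (Nat.div (@Nat.rec (fun _ => ℕ) 1 (fun (k acc : ℕ) => Nat.lor (@Nat.rec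 (fun _ => ℕ) ((fun (E : ℕ) => @List.rec ℕ (fun _ => ℕ) 0 (fun (x : ℕ) (_ : List ℕ) (acc : ℕ) => Nat.lor acc (Nat.shiftLeft E x)) [0, a, b, c]) 1) (fun (_ acc : ℕ) => (fun (E : ℕ) => @List.rec ℕ (fun _ => ℕ) 0 (fun (x : ℕ) (_ : List ℕ) (acc : ℕ) => Nat.lor acc (Nat.shiftLeft E x)) [0, a, b, c]) acc) k) (Nat.shiftLeft acc g)) 13) (2 ^ 1746)) 2) 1) || !(Nat.beq (Nat.mod (Nat.div (@Nat.rec (fun _ => ℕ) 1 (fun (k acc : ℕ) => Nat.lor (@Nat.rec (fun _ => ℕ) ((fun (E : ℕ) => @List.rec ℕ (fun _ => ℕ) 0 (fun (x : ℕ) (_ : List ℕ) (acc : ℕ) => Nat.lor acc (Nat.shiftLeft E x)) [0, a, b, c]) 1) (fun (_ acc : ℕ) => (fun (E : ℕ) => @List.rec ℕ (fun _ => ℕ) 0 (fun (x : ℕ) (_ : List ℕ) (acc : ℕ) => Nat.lor acc (Nat.shiftLeft E x)) [0, a, b, c]) acc) k) (Nat.shiftLeft acc g)) 13) (2 ^ 1748))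 2) 1))))) = true := W4
    rw [hleafA] at WL
    simp only [Bool.not_true, Bool.false_or, Bool.and_eq_true, Bool.or_eq_true, Bool.not_eq_true'] at WL
    obtain ⟨hnoT1, hnoT0T2⟩ := WL
    have hcontra : ∀ r, r ≤ 1748 →
        r ∈ (Finset.univ : Finset (Sym (Fin 5) 13)).image (fun s : Sym (Fin 5) 13 => ((s : Multiset (Fin 5)).map d).sum) →
        Nat.beq (Nat.mod (Nat.div (@Nat.rec (fun _ => ℕ) 1 (fun (k acc : ℕ) => Nat.lor (@Nat.rec (fun _ => ℕ) ((fun (E : ℕ) => @List.rec ℕ (fun _ => ℕ) 0 (fun (x : ℕ) (_ : List ℕ) (acc : ℕ) => Nat.lor acc (Nat.shiftLeft E x)) [0, a, b, c]) 1) (fun (_ acc : ℕ) => (fun (E : ℕ) => @List.rec ℕ (fun _ => ℕ) 0 (fun (x : ℕ) (_ : List ℕ) (acc : ℕ) => Nat.lor acc (Nat.shiftLeft E x)) [0, a, b, c]) acc) k) (Nat.shiftLeft acc g)) 13) (2 ^ r)) 2) 1 = false → False := by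
      intro r hr h hf
      have hb := hbit r hr h
      rw [hf] at hb
      exact Bool.false_ne_true hb
    rcases Nat.lt_or_ge (pencil d S).det.natDegree 1749 with hsmall | hbig
    · interval_cases h : (pencil d S).det.natDegree
      · exact hcontra 1747 (by omega) htop0 hnoT1
      · rcases hchain0 1746 (by omega) with h' | h'
        · rcases hnoT0T2 with hf | hf
          · exact hcontra 1746 (by omega) h' hf
          · exact hcontra 1748 (by omega) htop0 hf
        · exact hcontra 1747 (by omega) h' hnoT1
    · rcases hchain0 1746 (by omega) with h1 | h1
      · rcases hchain0 1747 (by omega) with h2 | h2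
        · exact hcontra 1747 (by omega) h2 hnoT1
        · rcases hnoT0T2 with hf | hf
          · exact hcontra 1746 (by omega) h1 hf
          · exact hcontra 1748 (by omega) h2 hf
      · exact hcontra 1747 (by omega) h1 hnoT1
  rcases Nat.lt_or_ge b 14 with hlt_s | hge1
  · exact peel 1 0 14 rfl (Nat.zero_le _) hlt_s sectorWalk_thirteen_five_s2_0_14
  · rcases Nat.lt_or_ge b 27 with hlt_s | hge2
    · exact peel 1 14 27 rfl hge1 hlt_s sectorWalk_thirteen_five_s2_14_27
    · exact peel 1 27 1750 rfl hge2 (hltC b (by simp)) sectorWalk_thirteen_five_s2_27_1750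

end Summit.ValiantsHypothesis.ValiantsHypothesis.Theorems.LacunarySymmetroidMatrixDescartes.FiniteSector
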